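import Summits.Ventures.WeilGRH.YoshidaGramEntryBoundsPrelim
import HarnessLib

/-!
# rh-explicit (venture WeilGRH): EXPLICIT TWO-SIDED BOUNDS FOR YOSHIDA'S GRAM ENTRIES `(χ_n, χ_m)`

Cell `rh-explicit`, WEIL TRACK (structure seat weil-3, gen13).  Pure real analysis; RH-free.  Continues
`YoshidaGramEntryBoundsPrelim.lean`.

With `ω_n = πn/a`, `P(a) = (4/a)(e^{a/2} − e^{−a/2})²`, `E(a) = e^{−a}/(1 − e^{−4a})`, the flat prime sum
`S(a) = Σ_{log k<2a} Λ(k)k^{-1/2}(1 − log k/2a)` and the plain prime sum `T(a) = Σ_{log k<2a} Λ(k)k^{-1/2}`, Yoshida's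
coefficients (1992, (5.15)/(5.16); `gramCoeff = polarCoeff + primeCoeff + archCoeff`) satisfy, for `|ω_n| ≥ 2`:

* DIAGONAL (`gramCoeff_diag_le`, `gramCoeff_diag_ge`):
  `|gramCoeff a n n − log(|ω_n|/2π)| ≤ 2S(a) + P(a)/(1+4ω_n²) + 3/ω_n² + 2/(a|ω_n|) + 4E(a)/(a(1+4ω_n²))`
  — the window form at a lattice height is `log(|ω_n|/2π)` up to the phase-blind `±2S(a)` and `O(1/|ω_n|)`;
* OFF-DIAGONAL (`abs_gramCoeff_offdiag_le`; `n ≠ m`, `ω_nω_m ≥ 0`, `|ω_n| ≤ |ω_m|`):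
  `|gramCoeff a n m| ≤ 2T(a)/(π|n − m|) + P(a)/(1+4ω_n²) + 2/(a|ω_n|) + 2E(a)/(π|n − m||ω_n|)`
  — the Gram matrix is diagonally concentrated: `|n − m|·|(χ_n, χ_m)| ≤ (2/π)T(a) + O(|n−m|/|ω_n|)`.

Ingredients per block: `abs_polarCoeff_diag_le` / `abs_polarCoeff_le` (polar, `O(1/ω²)`), `abs_primeCoeff_diag_le`
(`≤ 2S(a)`) / `abs_primeCoeff_le` (`≤ 2T(a)/(π|n−m|)`), `archCoeff_diag_le/ge`, `abs_archCoeff_le`.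
Used by `WeilSelbergWindowLaw.lean`.

No definitions, no named facts; RH-free.
-/

set_option autoImplicit false

noncomputable section

open Complex Filter Set Finset
open scoped Real Topology BigOperators ArithmeticFunction.vonMangoldt

namespace Summit.Ventures.WeilGRH

open Literature.NumberTheory.LFunctions Literature.NumberTheory.LFunctions.Yoshida1992
open Literature.Analysis.SpecialFunctions

variable {a : ℝ}

/-! ## The polar block -/

/-- Diagonal polar entry: `|polarCoeff a n n| ≤ P(a)/(1 + 4ω_n²)`. -/
theorem abs_polarCoeff_diag_le (ha : 0 < a) (n : ℤ) :
    |polarCoeff a n n| ≤ (4 / a) * (Real.exp (a / 2) - Real.exp (-(a / 2))) ^ 2 / (1 + 4 * freq a n ^ 2) := by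
  unfold polarCoeff
  set ω := freq a n
  set P : ℝ := (4 / a) * (Real.exp (a / 2) - Real.exp (-(a / 2))) ^ 2 with hP
  have hP0 : 0 ≤ P := by positivity
  have hsign : (-1 : ℝ) ^ (n + n) = 1 := Even.neg_one_zpow ⟨n, rfl⟩
  rw [hsign, one_mul]
  have hq : 0 < 1 + 4 * ω ^ 2 := by positivity
  rw [show (4 / a) * (Real.exp (a / 2) - Real.exp (-(a / 2))) ^ 2 * (1 - 4 * ω * ω) / ((1 + 4 * ω ^ 2) * (1 + 4 * ω ^ 2))
      = P * ((1 - 4 * ω * ω) / (1 + 4 * ω ^ 2) ^ 2) by rw [hP]; ring]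
  rw [abs_mul, abs_of_nonneg hP0, abs_div, abs_of_pos (by positivity : 0 < (1 + 4 * ω ^ 2) ^ 2)]
  rw [show P / (1 + 4 * ω ^ 2) = P * (1 / (1 + 4 * ω ^ 2)) by ring]
  refine mul_le_mul_of_nonneg_left ?_ hP0
  rw [div_le_div_iff₀ (by positivity) hq]
  have h1 : |1 - 4 * ω * ω| ≤ 1 + 4 * ω ^ 2 := by
    rw [abs_le]; constructor <;> nlinarith [sq_nonneg ω]
  nlinarith

/-- Off-diagonal polar entry: `|polarCoeff a n m| ≤ (P(a)/2)(1/(1+4ω_n²) + 1/(1+4ω_m²))`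
(`1 + 4|ω_nω_m| ≤ 1 + 2ω_n² + 2ω_m²`). -/
theorem abs_polarCoeff_le (ha : 0 < a) (n m : ℤ) :
    |polarCoeff a n m| ≤ (4 / a) * (Real.exp (a / 2) - Real.exp (-(a / 2))) ^ 2 / 2 *
      (1 / (1 + 4 * freq a n ^ 2) + 1 / (1 + 4 * freq a m ^ 2)) := by
  unfold polarCoeff
  set x := freq a n
  set y := freq a m
  set P : ℝ := (4 / a) * (Real.exp (a / 2) - Real.exp (-(a / 2))) ^ 2 with hP
  have hP0 : 0 ≤ P := by positivity
  have hx : 0 < 1 + 4 * x ^ 2 := by positivity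
  have hy : 0 < 1 + 4 * y ^ 2 := by positivity
  rw [show (-1 : ℝ) ^ (n + m) * (4 / a) * (Real.exp (a / 2) - Real.exp (-(a / 2))) ^ 2 * (1 - 4 * x * y) /
      ((1 + 4 * x ^ 2) * (1 + 4 * y ^ 2)) = (-1 : ℝ) ^ (n + m) * (P * ((1 - 4 * x * y) / ((1 + 4 * x ^ 2) * (1 + 4 * y ^ 2))))
      by rw [hP]; ring]
  rw [abs_mul, abs_neg_one_zpow, one_mul, abs_mul, abs_of_nonneg hP0,
    show P / 2 * (1 / (1 + 4 * x ^ 2) + 1 / (1 + 4 * y ^ 2)) = P * ((1 / (1 + 4 * x ^ 2) + 1 / (1 + 4 * y ^ 2)) / 2) by ring]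
  refine mul_le_mul_of_nonneg_left ?_ hP0
  rw [abs_div, abs_of_pos (by positivity : 0 < (1 + 4 * x ^ 2) * (1 + 4 * y ^ 2))]
  have key : (1 / (1 + 4 * x ^ 2) + 1 / (1 + 4 * y ^ 2)) / 2 = (1 + 2 * x ^ 2 + 2 * y ^ 2) / ((1 + 4 * x ^ 2) * (1 + 4 * y ^ 2)) := by
    field_simp; ring
  rw [key]
  refine div_le_div_of_nonneg_right ?_ (by positivity)
  rw [abs_le]
  constructor <;> nlinarith [sq_nonneg (x - y), sq_nonneg (x + y)]

/-! ## The prime block -/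

/-- Diagonal prime entry: `|primeCoeff a n n| ≤ 2S(a)`, `S(a) = Σ_{log k<2a} Λ(k)k^{-1/2}(1 − log k/2a)` (phase-blind). -/
theorem abs_primeCoeff_diag_le (ha : 0 < a) (n : ℤ) :
    |primeCoeff a n n| ≤ 2 * ∑ k ∈ weilPrimeIndex a, (Λ k : ℝ) / Real.sqrt k * (1 - Real.log k / (2 * a)) := by
  unfold primeCoeff incrCoeff
  simp only [if_true]
  rw [Finset.mul_sum]
  refine (Finset.abs_sum_le_sum_abs _ _).trans (Finset.sum_le_sum fun k hk ↦ ?_)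
  have hlog : Real.log k < 2 * a := mem_weilPrimeIndex.1 hk
  have hw : 0 ≤ 1 - Real.log k / (2 * a) := by
    rw [sub_nonneg, div_le_one (by linarith)]; exact hlog.le
  have hΛ : 0 ≤ (Λ k : ℝ) / Real.sqrt k := div_nonneg ArithmeticFunction.vonMangoldt_nonneg (Real.sqrt_nonneg _)
  have hcos := Real.abs_cos_le_one (freq a n * Real.log k)
  rw [show 2 - 2 * (1 - Real.log k / (2 * a)) * Real.cos (freq a n * Real.log k) - 2 =
      -(2 * (1 - Real.log k / (2 * a)) * Real.cos (freq a n * Real.log k)) by ring, abs_mul, abs_of_nonneg hΛ,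
    abs_neg, abs_mul, abs_of_nonneg (by positivity : (0 : ℝ) ≤ 2 * (1 - Real.log k / (2 * a)))]
  rw [show 2 * ((Λ k : ℝ) / Real.sqrt k * (1 - Real.log k / (2 * a))) =
      (Λ k : ℝ) / Real.sqrt k * (2 * (1 - Real.log k / (2 * a)) * 1) by ring]
  gcongr

/-- Off-diagonal prime entry: `|primeCoeff a n m| ≤ 2T(a)/(π|n − m|)`, `T(a) = Σ_{log k<2a} Λ(k)k^{-1/2}`. -/
theorem abs_primeCoeff_le {n m : ℤ} (hnm : n ≠ m) :
    |primeCoeff a n m| ≤ 2 / (π * |(n : ℝ) - m|) * ∑ k ∈ weilPrimeIndex a, (Λ k : ℝ) / Real.sqrt k := by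
  unfold primeCoeff incrCoeff
  simp only [if_neg hnm, sub_zero]
  rw [Finset.mul_sum]
  refine (Finset.abs_sum_le_sum_abs _ _).trans (Finset.sum_le_sum fun k _ ↦ ?_)
  have hΛ : 0 ≤ (Λ k : ℝ) / Real.sqrt k := div_nonneg ArithmeticFunction.vonMangoldt_nonneg (Real.sqrt_nonneg _)
  have hnm' : (n : ℝ) - m ≠ 0 := sub_ne_zero.2 (by exact_mod_cast hnm)
  have hden : 0 < π * |(n : ℝ) - m| := mul_pos Real.pi_pos (abs_pos.2 hnm')
  rw [abs_mul, abs_of_nonneg hΛ, mul_comm (2 / (π * |(n : ℝ) - m|))]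
  refine mul_le_mul_of_nonneg_left ?_ hΛ
  rw [abs_div, abs_mul, abs_neg, abs_neg_one_zpow, one_mul, abs_mul, abs_of_pos Real.pi_pos, div_le_div_iff₀ hden hden]
  have hs1 := Real.abs_sin_le_one (freq a m * Real.log k)
  have hs2 := Real.abs_sin_le_one (freq a n * Real.log k)
  have h2 : |Real.sin (freq a m * Real.log k) - Real.sin (freq a n * Real.log k)| ≤ 2 := by
    refine (abs_sub _ _).trans ?_; linarith
  nlinarith [hden]

/-! ## The archimedean block -/

/-- Diagonal archimedean entry from above (`|ω_n| ≥ 2`):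
`archCoeff a n n ≤ log(|ω_n|/2π) + 2/ω_n² + 2/(a|ω_n|) + 4E(a)/(a(1+4ω_n²))`. -/
theorem archCoeff_diag_le (ha : 0 < a) {n : ℤ} (hω : 2 ≤ |freq a n|) :
    archCoeff a n n ≤ Real.log (|freq a n| / (2 * π)) + 2 / freq a n ^ 2 + 2 / (a * |freq a n|) +
      4 * (Real.exp (-a) / (1 - Real.exp (-(4 * a)))) / (a * (1 + 4 * freq a n ^ 2)) := by
  unfold archCoeff
  simp only [if_true]
  set ω := freq a n
  have hω0 : 0 < |ω| := by linarith
  have hlog : Real.log (|ω| / (2 * π)) = Real.log (|ω| / 2) - Real.log π := by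
    rw [show |ω| / (2 * π) = |ω| / 2 / π by ring, Real.log_div (by positivity) Real.pi_pos.ne']
  have h1 := reDigammaQuarter_le_log_half_add hω
  have h2 := abs_re_deriv_digamma_quarter_le hω
  have h3 := abs_archExpSumDiag_le ha n
  have h2' : (deriv Complex.digamma (1 / 4 + (ω : ℂ) / 2 * I)).re / (4 * a) ≤ 2 / (a * |ω|) := by
    rw [div_le_iff₀ (by positivity)]
    calc (deriv Complex.digamma (1 / 4 + (ω : ℂ) / 2 * I)).re ≤ 8 / |ω| := (le_abs_self _).trans h2
      _ = 2 / (a * |ω|) * (4 * a) := by field_simp; ring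
  have h3' : -(archExpSumDiag a n / a) ≤ 4 * (Real.exp (-a) / (1 - Real.exp (-(4 * a)))) / (a * (1 + 4 * ω ^ 2)) := by
    have hneg : -archExpSumDiag a n ≤ 4 * (Real.exp (-a) / (1 - Real.exp (-(4 * a)))) / (1 + 4 * ω ^ 2) :=
      (neg_le_abs _).trans h3
    rw [show -(archExpSumDiag a n / a) = (-archExpSumDiag a n) / a by ring,
      show 4 * (Real.exp (-a) / (1 - Real.exp (-(4 * a)))) / (a * (1 + 4 * ω ^ 2)) =
        4 * (Real.exp (-a) / (1 - Real.exp (-(4 * a)))) / (1 + 4 * ω ^ 2) / a by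
          rw [div_div, mul_comm (1 + 4 * ω ^ 2) a]]
    exact div_le_div_of_nonneg_right hneg ha.le
  rw [hlog]
  have : reDigammaQuarter ω - Real.log π + (deriv Complex.digamma (1 / 4 + (ω : ℂ) / 2 * I)).re / (4 * a) -
      archExpSumDiag a n / a = (reDigammaQuarter ω - Real.log π) +
      (deriv Complex.digamma (1 / 4 + (ω : ℂ) / 2 * I)).re / (4 * a) + -(archExpSumDiag a n / a) := by ring
  rw [this]
  linarith

/-- Diagonal archimedean entry from below (`|ω_n| ≥ 2`):
`log(|ω_n|/2π) − 3/ω_n² − 2/(a|ω_n|) − 4E(a)/(a(1+4ω_n²)) ≤ archCoeff a n n`. -/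
theorem archCoeff_diag_ge (ha : 0 < a) {n : ℤ} (hω : 2 ≤ |freq a n|) :
    Real.log (|freq a n| / (2 * π)) - 3 / freq a n ^ 2 - 2 / (a * |freq a n|) -
      4 * (Real.exp (-a) / (1 - Real.exp (-(4 * a)))) / (a * (1 + 4 * freq a n ^ 2)) ≤ archCoeff a n n := by
  unfold archCoeff
  simp only [if_true]
  set ω := freq a n
  have hω0 : 0 < |ω| := by linarith
  have hlog : Real.log (|ω| / (2 * π)) = Real.log (|ω| / 2) - Real.log π := by
    rw [show |ω| / (2 * π) = |ω| / 2 / π by ring, Real.log_div (by positivity) Real.pi_pos.ne']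
  have h1 := log_half_sub_le_reDigammaQuarter hω
  have h2 := abs_re_deriv_digamma_quarter_le hω
  have h3 := abs_archExpSumDiag_le ha n
  have h2' : -(2 / (a * |ω|)) ≤ (deriv Complex.digamma (1 / 4 + (ω : ℂ) / 2 * I)).re / (4 * a) := by
    rw [le_div_iff₀ (by positivity)]
    calc -(2 / (a * |ω|)) * (4 * a) = -(8 / |ω|) := by field_simp; ring
      _ ≤ (deriv Complex.digamma (1 / 4 + (ω : ℂ) / 2 * I)).re := (abs_le.1 h2).1
  have h3' : archExpSumDiag a n / a ≤ 4 * (Real.exp (-a) / (1 - Real.exp (-(4 * a)))) / (a * (1 + 4 * ω ^ 2)) := by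
    rw [show 4 * (Real.exp (-a) / (1 - Real.exp (-(4 * a)))) / (a * (1 + 4 * ω ^ 2)) =
        4 * (Real.exp (-a) / (1 - Real.exp (-(4 * a)))) / (1 + 4 * ω ^ 2) / a by
          rw [div_div, mul_comm (1 + 4 * ω ^ 2) a]]
    exact div_le_div_of_nonneg_right ((le_abs_self _).trans h3) ha.le
  rw [hlog]
  linarith

/-- `4|x|/(1 + 4x²) ≤ 1/|y|` whenever `0 < |y| ≤ |x|`. -/
theorem four_mul_abs_div_le_inv {x y : ℝ} (hy : 0 < |y|) (hle : |y| ≤ |x|) :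
    4 * |x| / (1 + 4 * x ^ 2) ≤ 1 / |y| := by
  rw [div_le_div_iff₀ (by positivity) hy]
  have hx2 : x ^ 2 = |x| ^ 2 := (sq_abs x).symm
  rw [hx2]
  nlinarith [mul_le_mul hle hle hy.le (abs_nonneg x)]

/-- Off-diagonal archimedean entry (`n ≠ m`, `ω_nω_m ≥ 0`, `2 ≤ |ω_n| ≤ |ω_m|`):
`|archCoeff a n m| ≤ 2/(a|ω_n|) + 2E(a)/(π|n − m||ω_n|)`. -/
theorem abs_archCoeff_le (ha : 0 < a) {n m : ℤ} (hnm : n ≠ m) (hω : 2 ≤ |freq a n|)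
    (hle : |freq a n| ≤ |freq a m|) (hs : 0 ≤ freq a n * freq a m) :
    |archCoeff a n m| ≤ 2 / (a * |freq a n|) +
      2 * (Real.exp (-a) / (1 - Real.exp (-(4 * a)))) / (π * |(n : ℝ) - m| * |freq a n|) := by
  unfold archCoeff
  simp only [if_neg hnm]
  set x := freq a n with hx
  set y := freq a m with hy
  set E : ℝ := Real.exp (-a) / (1 - Real.exp (-(4 * a))) with hE
  have hE0 : 0 < E := expSumConst_pos ha
  have hx0 : 0 < |x| := by linarith
  have hnm' : (n : ℝ) - m ≠ 0 := sub_ne_zero.2 (by exact_mod_cast hnm)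
  have hden : 0 < π * |(n : ℝ) - m| := mul_pos Real.pi_pos (abs_pos.2 hnm')
  -- the difference of frequencies
  have hdiff : |y - x| = π * |(n : ℝ) - m| / a := by
    rw [hy, hx, freq, freq, show π * (m : ℝ) / a - π * n / a = (π / a) * ((m : ℝ) - n) by ring, abs_mul,
      abs_of_pos (div_pos Real.pi_pos ha), abs_sub_comm]
    ring
  -- the bracket
  have hIm := abs_im_digamma_quarter_sub_le hω hs hle
  have hEm : |archExpSumSin a m| ≤ E * (1 / |x|) := by
    refine (abs_archExpSumSin_le ha m).trans ?_
    rw [show 4 * (Real.exp (-a) / (1 - Real.exp (-(4 * a)))) * |freq a m| / (1 + 4 * freq a m ^ 2) =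
      E * (4 * |y| / (1 + 4 * y ^ 2)) by rw [hE, hy]; ring]
    exact mul_le_mul_of_nonneg_left (four_mul_abs_div_le_inv hx0 hle) hE0.le
  have hEn : |archExpSumSin a n| ≤ E * (1 / |x|) := by
    refine (abs_archExpSumSin_le ha n).trans ?_
    rw [show 4 * (Real.exp (-a) / (1 - Real.exp (-(4 * a)))) * |freq a n| / (1 + 4 * freq a n ^ 2) =
      E * (4 * |x| / (1 + 4 * x ^ 2)) by rw [hE, hx]; ring]
    exact mul_le_mul_of_nonneg_left (four_mul_abs_div_le_inv hx0 le_rfl) hE0.le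
  have hD : |((Complex.digamma (1 / 4 + ((y : ℝ) : ℂ) / 2 * I)).im / 2 - archExpSumSin a m) -
      ((Complex.digamma (1 / 4 + ((x : ℝ) : ℂ) / 2 * I)).im / 2 - archExpSumSin a n)| ≤
      2 * (π * |(n : ℝ) - m| / a) / |x| + 2 * (E * (1 / |x|)) := by
    have e : ((Complex.digamma (1 / 4 + ((y : ℝ) : ℂ) / 2 * I)).im / 2 - archExpSumSin a m) -
        ((Complex.digamma (1 / 4 + ((x : ℝ) : ℂ) / 2 * I)).im / 2 - archExpSumSin a n) =
        ((Complex.digamma (1 / 4 + ((y : ℝ) : ℂ) / 2 * I)).im - (Complex.digamma (1 / 4 + ((x : ℝ) : ℂ) / 2 * I)).im) / 2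
          + (-archExpSumSin a m + archExpSumSin a n) := by ring
    rw [e]
    refine (abs_add_le _ _).trans ?_
    have hA : |((Complex.digamma (1 / 4 + ((y : ℝ) : ℂ) / 2 * I)).im -
        (Complex.digamma (1 / 4 + ((x : ℝ) : ℂ) / 2 * I)).im) / 2| ≤ 2 * (π * |(n : ℝ) - m| / a) / |x| := by
      rw [abs_div, abs_of_pos (by norm_num : (0 : ℝ) < 2), div_le_iff₀ (by norm_num : (0 : ℝ) < 2), ← hdiff]
      calc |(Complex.digamma (1 / 4 + ((y : ℝ) : ℂ) / 2 * I)).im - (Complex.digamma (1 / 4 + ((x : ℝ) : ℂ) / 2 * I)).im|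
          ≤ 4 * |y - x| / |x| := hIm
        _ = 2 * |y - x| / |x| * 2 := by ring
    have hB : |-archExpSumSin a m + archExpSumSin a n| ≤ 2 * (E * (1 / |x|)) := by
      refine (abs_add_le _ _).trans ?_
      rw [abs_neg]
      linarith
    linarith
  -- assemble
  rw [abs_mul, abs_div, abs_neg, abs_neg_one_zpow, abs_mul, abs_of_pos Real.pi_pos]
  calc 1 / (π * |(n : ℝ) - m|) * |((Complex.digamma (1 / 4 + ((y : ℝ) : ℂ) / 2 * I)).im / 2 - archExpSumSin a m) -
        ((Complex.digamma (1 / 4 + ((x : ℝ) : ℂ) / 2 * I)).im / 2 - archExpSumSin a n)|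
      ≤ 1 / (π * |(n : ℝ) - m|) * (2 * (π * |(n : ℝ) - m| / a) / |x| + 2 * (E * (1 / |x|))) :=
        mul_le_mul_of_nonneg_left hD (by positivity)
    _ = 2 / (a * |x|) + 2 * E / (π * |(n : ℝ) - m| * |x|) := by
        field_simp

/-! ## Yoshida's Gram entries -/

/-- **DIAGONAL GRAM ENTRY FROM ABOVE** (`|ω_n| ≥ 2`):
`gramCoeff a n n ≤ log(|ω_n|/2π) + 2S(a) + P(a)/(1+4ω_n²) + 2/ω_n² + 2/(a|ω_n|) + 4E(a)/(a(1+4ω_n²))`. -/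
theorem gramCoeff_diag_le (ha : 0 < a) {n : ℤ} (hω : 2 ≤ |freq a n|) :
    gramCoeff a n n ≤ Real.log (|freq a n| / (2 * π)) +
      2 * (∑ k ∈ weilPrimeIndex a, (Λ k : ℝ) / Real.sqrt k * (1 - Real.log k / (2 * a))) +
      ((4 / a) * (Real.exp (a / 2) - Real.exp (-(a / 2))) ^ 2 / (1 + 4 * freq a n ^ 2) + 2 / freq a n ^ 2 +
        2 / (a * |freq a n|) + 4 * (Real.exp (-a) / (1 - Real.exp (-(4 * a)))) / (a * (1 + 4 * freq a n ^ 2))) := by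
  unfold gramCoeff
  have h1 := (le_abs_self _).trans (abs_polarCoeff_diag_le ha n)
  have h2 := (le_abs_self _).trans (abs_primeCoeff_diag_le ha n)
  have h3 := archCoeff_diag_le ha hω
  linarith

/-- **DIAGONAL GRAM ENTRY FROM BELOW** (`|ω_n| ≥ 2`):
`log(|ω_n|/2π) − 2S(a) − P(a)/(1+4ω_n²) − 3/ω_n² − 2/(a|ω_n|) − 4E(a)/(a(1+4ω_n²)) ≤ gramCoeff a n n`. -/
theorem gramCoeff_diag_ge (ha : 0 < a) {n : ℤ} (hω : 2 ≤ |freq a n|) :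
    Real.log (|freq a n| / (2 * π)) -
      2 * (∑ k ∈ weilPrimeIndex a, (Λ k : ℝ) / Real.sqrt k * (1 - Real.log k / (2 * a))) -
      ((4 / a) * (Real.exp (a / 2) - Real.exp (-(a / 2))) ^ 2 / (1 + 4 * freq a n ^ 2) + 3 / freq a n ^ 2 +
        2 / (a * |freq a n|) + 4 * (Real.exp (-a) / (1 - Real.exp (-(4 * a)))) / (a * (1 + 4 * freq a n ^ 2))) ≤
      gramCoeff a n n := by
  unfold gramCoeff
  have h1 := (neg_abs_le _).trans' (neg_le_neg (abs_polarCoeff_diag_le ha n))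
  have h2 := (neg_abs_le _).trans' (neg_le_neg (abs_primeCoeff_diag_le ha n))
  have h3 := archCoeff_diag_ge ha hω
  linarith

/-- **OFF-DIAGONAL GRAM ENTRY** (`n ≠ m`, `ω_nω_m ≥ 0`, `2 ≤ |ω_n| ≤ |ω_m|`):
`|gramCoeff a n m| ≤ 2T(a)/(π|n−m|) + P(a)/(1+4ω_n²) + 2/(a|ω_n|) + 2E(a)/(π|n−m||ω_n|)`. -/
theorem abs_gramCoeff_offdiag_le (ha : 0 < a) {n m : ℤ} (hnm : n ≠ m) (hω : 2 ≤ |freq a n|)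
    (hle : |freq a n| ≤ |freq a m|) (hs : 0 ≤ freq a n * freq a m) :
    |gramCoeff a n m| ≤ 2 / (π * |(n : ℝ) - m|) * (∑ k ∈ weilPrimeIndex a, (Λ k : ℝ) / Real.sqrt k) +
      (4 / a) * (Real.exp (a / 2) - Real.exp (-(a / 2))) ^ 2 / (1 + 4 * freq a n ^ 2) + 2 / (a * |freq a n|) +
      2 * (Real.exp (-a) / (1 - Real.exp (-(4 * a)))) / (π * |(n : ℝ) - m| * |freq a n|) := by
  unfold gramCoeff
  have h1 := abs_polarCoeff_le ha n m
  have h2 := abs_primeCoeff_le (a := a) hnm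
  have h3 := abs_archCoeff_le ha hnm hω hle hs
  have hP0 : 0 ≤ (4 / a) * (Real.exp (a / 2) - Real.exp (-(a / 2))) ^ 2 := by positivity
  have hmono : 1 / (1 + 4 * freq a m ^ 2) ≤ 1 / (1 + 4 * freq a n ^ 2) := by
    have : freq a n ^ 2 ≤ freq a m ^ 2 := by
      rw [← sq_abs (freq a n), ← sq_abs (freq a m)]
      exact pow_le_pow_left₀ (abs_nonneg _) hle 2
    exact one_div_le_one_div_of_le (by positivity) (by linarith)
  have h1' : |polarCoeff a n m| ≤ (4 / a) * (Real.exp (a / 2) - Real.exp (-(a / 2))) ^ 2 / (1 + 4 * freq a n ^ 2) := by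
    refine h1.trans ?_
    calc (4 / a) * (Real.exp (a / 2) - Real.exp (-(a / 2))) ^ 2 / 2 * (1 / (1 + 4 * freq a n ^ 2) + 1 / (1 + 4 * freq a m ^ 2))
        ≤ (4 / a) * (Real.exp (a / 2) - Real.exp (-(a / 2))) ^ 2 / 2 * (1 / (1 + 4 * freq a n ^ 2) + 1 / (1 + 4 * freq a n ^ 2)) := by
          gcongr
      _ = (4 / a) * (Real.exp (a / 2) - Real.exp (-(a / 2))) ^ 2 / (1 + 4 * freq a n ^ 2) := by ring
  calc |polarCoeff a n m + primeCoeff a n m + archCoeff a n m|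
      ≤ |polarCoeff a n m| + |primeCoeff a n m| + |archCoeff a n m| := abs_add_three _ _ _
    _ ≤ _ := by linarith

end Summit.Ventures.WeilGRH

end
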